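import Literature.NumberTheory.EllipticCurves.HeegnerPointsKolyvaginExceptionalTwistProofs
import Literature.NumberTheory.EllipticCurves.HeegnerPointsModularityProofs
import Literature.NumberTheory.NumberFields.StickelbergerDiscriminant
import HarnessLib

/-!
# bsd.S17 (`rank_eq_analyticRank_of_analyticRank_le_one`) with Kolyvagin's Theorem A asked only
# under its PRIMARY AUTHOR's standing hypothesis `D ≠ -3, -4` — equivalently `|d_K| > 4`

Topic `NumberTheory/EllipticCurves`; a proofs-only companion (theorems only: no definition, no
named fact, nothing restated; D-0026) of `HeegnerPoints.lean` (named fact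
`Literature.NumberTheory.EllipticCurves.kolyvagin N W K`, Kolyvagin 1990 Thm. A) and of
`LeadingTerm.lean` (named fact `Literature.NumberTheory.EllipticCurves.rank_eq_analyticRank_of_analyticRank_le_one`
= bsd.S17 = registry A18, Darmon 2004 Thm. 3.22).

## Why (ARM P, cell `pub/bsd-cited/`, row 5 / §1 #9 hGZK; referee C2 ROUND 370 (γ); TY-QUEUE 17)

Reader r05's D-audit of A18 (sheet `D-AUDIT-r05.md` 1ec359a4a398eee7 + ADDENDUM-1
38c91620a6887cba) records that every PRIMARY-author statement of Kolyvagin's Theorem A carries the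
standing hypothesis `D ≠ -3, -4` (units of `K`): Kolyvagin, ICM Kyoto 1990, Vol. I, p. 431 «Let
`D` be a fundamental discriminant of the imaginary-quadratic field `K = ℚ(√D)` such that
`D ≡ □ (mod 4N)`, `D ≠ −3, −4`»; Izv. 52:6 (1988) Thm. B; Gross 1991 Thm. 1.3 «for simplicity, we
assume that `D ≠ 3, 4`»; Howard 2004 — while the refereed restatements McCallum 1991 §1,
Perrin-Riou (Sém. Bourbaki 717) Thm. 1.3 and Nekovář 2007 Thm. 3.2 print and prove it without that
restriction (referee C2 R370: «`u_K > 1` slice = named print, no flag, no GAP»). The tree's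
`kolyvagin N W K` is the unrestricted form. The referee target **T-r05-U** («A18 from the same
five named inputs with Kolyvagin's theorem needed ONLY at `|d_K| > 4`») was ENDORSED by C2 R370 (γ)
as a census-neutral robustness swap and typed in the reader's staging file
`staging/bsd-cited-r05/KolyvaginPrimaryHypothesesR05.lean` (5982d963bbffc4fe).

## What the tree already had, and what this file adds

The assembly of Darmon's proof of Thm. 3.22 with the auxiliary Heegner field taken at `|d_K| > 4`
— so that Theorem A is invoked only at fields with `d_K ∉ {-3, -4}` — is ALREADY a theorem of the
tree: `exists_heegnerField_four_lt_analyticRankEK_eq_one_of`,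
`rank_eq_analyticRank_of_isGloballyMinimal_of_thmA_on`, `rank_eq_analyticRank_of_thmA_on` and
`rank_eq_analyticRank_of_thmA_discr_ne` (`HeegnerPointsKolyvaginExceptionalTwistProofs.lean`, §B,
2026-08-15; hypothesis spelled `NumberField.discr K ≠ -3 ∧ NumberField.discr K ≠ -4`, i.e. the
primary author's «`D ≠ −3, −4`» VERBATIM). The staging file's Proof section re-derives the same
three steps (copied from `LeadingTermProofs` / `LeadingTermHeegnerProofs`) with the bound spelled
`4 < (NumberField.discr K).natAbs`; it is therefore NOT re-landed (typer lint rule: cite the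
existing declaration, never restate a near-duplicate). This file adds only:

* `IsImaginaryQuadratic.four_lt_natAbs_discr_of_discr_ne`, `…four_lt_natAbs_discr_iff` — on an
  imaginary quadratic field the two spellings of the primary hypothesis agree:
  `4 < |d_K| ↔ d_K ≠ -3 ∧ d_K ≠ -4` (`d_K < 0`, `IsImaginaryQuadratic.discr_neg`; Stickelberger
  `d_K ≡ 0, 1 (mod 4)`, `Literature.NumberTheory.NumberFields.stickelberger_discr_emod_four`; the
  direction `→` is the tree's `discr_ne_of_four_lt`);
* `kolyvagin_of_discr_ne_of_four_lt`, `kolyvagin_of_four_lt_of_discr_ne`,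
  `forall_kolyvagin_discr_ne_iff_forall_kolyvagin_four_lt` — hence the two restricted Kolyvagin
  inputs «`kolyvagin N W K` whenever `d_K ∉ {-3, -4}`» and «… whenever `|d_K| > 4`» are the same
  hypothesis (as `kolyvagin N W K` itself asks `IsImaginaryQuadratic K`);
* `rank_eq_analyticRank_of_analyticRank_le_one_of_modularity_of_thmA_discr_ne` — the named fact
  A18 from modularity (`existsUnique_isNewformOf`), Waldspurger, Murty–Murty, Gross–Zagier, Heegner
  points over `K` and Kolyvagin's theorem ONLY at `d_K ∉ {-3, -4}`: the tree's
  `rank_eq_analyticRank_of_analyticRank_le_one_of_modularity''` (`HeegnerPointReflectionHolds`)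
  with its Kolyvagin input restricted to the primary author's hypothesis
  (= `rank_eq_analyticRank_of_thmA_discr_ne` with parity and holomorphy supplied from `hmod`);
* `rank_eq_analyticRank_of_analyticRank_le_one_of_nonempty_modularParametrizationData_of_thmA_discr_ne`
  and `…_of_thmA_four_lt` — **T-r05-U**: A18 from BCDT's Theorem A in form (6)
  (`nonempty_modularParametrizationData`, which supplies the Heegner points,
  `exists_isHeegnerPoint_of_nonempty_modularParametrizationData`), Waldspurger, Murty–Murty,
  Gross–Zagier and Kolyvagin restricted to `d_K ∉ {-3, -4}`, resp. to `4 < |d_K|` — the latter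
  with EXACTLY the antecedents of the staging file's `rankLeOne_of_kolyvaginPrimary_TARGET`
  (so that target is a theorem of the tree by name); compare the unrestricted
  `rank_eq_analyticRank_of_analyticRank_le_one_of_nonempty_modularParametrizationData`
  (`HeegnerPointsModularityProofs`).

No statement of the tree is changed (`kolyvagin`, A18 byte-identical); no definition and no
named fact is added; nothing is discharged (A18's open content is that of its five inputs).

## References

* V. A. Kolyvagin, *Euler systems*, The Grothendieck Festschrift II, Progr. Math. 87 (1990),
  435–483, Thm. A; ICM Kyoto 1990, Vol. I, 429–436 (standing hypothesis p. 431). [Kolyvagin1990]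
* B. H. Gross, *Kolyvagin's work on modular elliptic curves*, LMS Lecture Note Ser. 153 (1991),
  235–256, §1 Thm. 1.3 («for simplicity, we assume that `D ≠ 3, 4`»). [GrossLMS1991]
* W. G. McCallum, *Kolyvagin's work on Shafarevich–Tate groups*, LMS Lecture Note Ser. 153 (1991),
  295–316, §1 Theorem (Kolyvagin). [McCallumLMS1991]
* H. Darmon, *Rational points on modular elliptic curves*, CBMS 101, AMS 2004, Thm. 3.22 and §3.9.
  [Darmon2004]
* C. Breuil, B. Conrad, F. Diamond, R. Taylor, J. Amer. Math. Soc. 14 (2001), 843–939, Theorem A,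
  p. 845 form (6). [BCDTJAMS2001]
-/

noncomputable section

open scoped Classical

open WeierstrassCurve

namespace Literature.NumberTheory.EllipticCurves

universe u

/-! ## §1. The two spellings of the primary author's hypothesis on an imaginary quadratic field -/

section Discriminant

variable {K : Type u} [Field K] [NumberField K]

/-- On an imaginary quadratic field, `d_K ∉ {-3, -4}` forces `|d_K| > 4` (indeed `|d_K| ≥ 7`):
`d_K < 0` (`IsImaginaryQuadratic.discr_neg`) and Stickelberger's `d_K ≡ 0, 1 (mod 4)` leave
`-3, -4, -7, -8, …` as the only possible values — so Gross's «`D ≠ 3, 4`» excludes exactly the two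
imaginary quadratic fields with extra units. [cite: GrossLMS1991, §1 Thm. 1.3]
[cite: Ash2010, §2.3 Problems 1–3 (PDF p. 19)] -/
theorem IsImaginaryQuadratic.four_lt_natAbs_discr_of_discr_ne (hK : IsImaginaryQuadratic K)
    (hD : NumberField.discr K ≠ -3 ∧ NumberField.discr K ≠ -4) :
    4 < (NumberField.discr K).natAbs := by
  have hneg : NumberField.discr K < 0 := hK.discr_neg
  have h4 := Literature.NumberTheory.NumberFields.stickelberger_discr_emod_four K
  omega

/-- On an imaginary quadratic field the two spellings of Kolyvagin's / Gross's standing hypothesis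
agree: `|d_K| > 4 ↔ d_K ≠ -3 ∧ d_K ≠ -4` (`→` is the tree's `discr_ne_of_four_lt`, valid for any
number field). [cite: GrossLMS1991, §1 Thm. 1.3] [cite: Ash2010, §2.3 Problems 1–3 (PDF p. 19)] -/
theorem IsImaginaryQuadratic.four_lt_natAbs_discr_iff (hK : IsImaginaryQuadratic K) :
    4 < (NumberField.discr K).natAbs ↔ NumberField.discr K ≠ -3 ∧ NumberField.discr K ≠ -4 :=
  ⟨discr_ne_of_four_lt, hK.four_lt_natAbs_discr_of_discr_ne⟩

end Discriminant

/-! ## §2. Kolyvagin's theorem restricted to the primary hypothesis: the two spellings agree -/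

section KolyvaginRestricted

variable {N : ℕ} [NeZero N] {W : WeierstrassCurve ℚ} {K : Type u} [Field K] [NumberField K]

/-- `kolyvagin N W K` granted at `|d_K| > 4` gives it at `d_K ∉ {-3, -4}`: the fact itself asks
`IsImaginaryQuadratic K`, on which the two guards agree
(`IsImaginaryQuadratic.four_lt_natAbs_discr_of_discr_ne`): Gross's standing hypothesis
«`D ≠ 3, 4`» in either spelling. [cite: GrossLMS1991, §1 Thm. 1.3] -/
theorem kolyvagin_of_discr_ne_of_four_lt (hKo : 4 < (NumberField.discr K).natAbs → kolyvagin N W K)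
    (hD : NumberField.discr K ≠ -3 ∧ NumberField.discr K ≠ -4) : kolyvagin N W K := by
  intro _ hK hH P hP hnt
  exact hKo (hK.four_lt_natAbs_discr_of_discr_ne hD) hK hH hP hnt

/-- `kolyvagin N W K` granted at `d_K ∉ {-3, -4}` gives it at `|d_K| > 4` (`discr_ne_of_four_lt`):
Gross's standing hypothesis «`D ≠ 3, 4`» in either spelling. [cite: GrossLMS1991, §1 Thm. 1.3] -/
theorem kolyvagin_of_four_lt_of_discr_ne
    (hKo : NumberField.discr K ≠ -3 ∧ NumberField.discr K ≠ -4 → kolyvagin N W K)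
    (h4 : 4 < (NumberField.discr K).natAbs) : kolyvagin N W K :=
  hKo (discr_ne_of_four_lt h4)

end KolyvaginRestricted

/-- The two restricted Kolyvagin inputs of the BSD rank-`≤ 1` assembly are the SAME hypothesis:
«Theorem A whenever `d_K ∉ {-3, -4}`» (the primary author's «`D ≠ −3, −4`», Kolyvagin ICM 1990
p. 431; Gross 1991 Thm. 1.3) `↔` «Theorem A whenever `|d_K| > 4`» (the bound offered by the
tree's Waldspurger / Murty–Murty facts, `∀ B, ∃ K, B < |d_K| ∧ …`).
[cite: GrossLMS1991, §1 Thm. 1.3] -/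
theorem forall_kolyvagin_discr_ne_iff_forall_kolyvagin_four_lt :
    (∀ (N : ℕ) [NeZero N] (W : WeierstrassCurve ℚ) (K : Type) [Field K] [NumberField K],
      NumberField.discr K ≠ -3 ∧ NumberField.discr K ≠ -4 → kolyvagin N W K) ↔
    (∀ (N : ℕ) [NeZero N] (W : WeierstrassCurve ℚ) (K : Type) [Field K] [NumberField K],
      4 < (NumberField.discr K).natAbs → kolyvagin N W K) :=
  ⟨fun h N _ W K _ _ h4 ↦ kolyvagin_of_four_lt_of_discr_ne (h N W K) h4,
    fun h N _ W K _ _ hD ↦ kolyvagin_of_discr_ne_of_four_lt (h N W K) hD⟩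

/-! ## §3. T-r05-U: bsd.S17 from the five named inputs with Kolyvagin only at `D ≠ -3, -4` -/

section TR05U

open ModularForms

/-- **bsd.S17 from modularity, the analytic named facts, Heegner points over `K`, and Kolyvagin's
Theorem A ONLY under its primary author's hypothesis `d_K ∉ {-3, -4}`** (Kolyvagin ICM 1990 p. 431;
Gross 1991 Thm. 1.3): the tree's `rank_eq_analyticRank_of_analyticRank_le_one_of_modularity''`
(`HeegnerPointReflectionHolds`) with its Kolyvagin input `hKo` RESTRICTED — the restriction costs
nothing because Darmon's auxiliary Heegner field can be taken with `|d_K| > 4`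
(`rank_eq_analyticRank_of_thmA_discr_ne`, `HeegnerPointsKolyvaginExceptionalTwistProofs` §B; parity
and holomorphy of `L(E, s)` from `hmod` as in §F there).
[cite: Darmon2004, Thm. 3.22 and §3.9] [cite: GrossLMS1991, §1 Thm. 1.3] -/
theorem rank_eq_analyticRank_of_analyticRank_le_one_of_modularity_of_thmA_discr_ne
    (hmod : existsUnique_isNewformOf)
    (hWa : waldspurger_exists_heegnerField_twist_ne_zero)
    (hMM : murtyMurty_exists_heegnerField_twist_simpleZero)
    (hGZ : ∀ (N : ℕ) [NeZero N] (W : WeierstrassCurve ℚ) (K : Type) [Field K] [NumberField K],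
      gross_zagier N W K)
    (hHP : ∀ (W : WeierstrassCurve ℚ) (K : Type) [Field K] [NumberField K],
      exists_isHeegnerPoint W K)
    (hKo : ∀ (N : ℕ) [NeZero N] (W : WeierstrassCurve ℚ) (K : Type) [Field K] [NumberField K],
      NumberField.discr K ≠ -3 ∧ NumberField.discr K ≠ -4 → kolyvagin N W K) :
    rank_eq_analyticRank_of_analyticRank_le_one := by
  intro W _ h
  have hE : hasEntireLFunction_rat := WeierstrassCurve.hasEntireLFunction_rat_of_modularity hmod
  have hpar : ∀ W : WeierstrassCurve ℚ, W.even_analyticRank_iff := fun W ↦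
    W.even_analyticRank_iff_of hE (W.hasFunctionalEquationSign_rootNumber_of_modularity hmod
      (fun N _ ↦ (isNewform0_exists_functional_equation_two_and N).1)
      (fun N _ ↦ (isNewform0_exists_functional_equation_two_and N).2))
  exact rank_eq_analyticRank_of_thmA_discr_ne hpar hWa hMM hE hGZ hHP hKo W h

/-- **T-r05-U (primary-hypothesis spelling): bsd.S17 from five named inputs, Kolyvagin's theorem
only at `d_K ∉ {-3, -4}`.** BCDT's Theorem A in form (6) (`nonempty_modularParametrizationData`:
it gives Version `L` with uniqueness, `existsUnique_isNewformOf_iff`, and the Heegner points over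
`K`, `exists_isHeegnerPoint_of_nonempty_modularParametrizationData`), Waldspurger, Murty–Murty,
Gross–Zagier, and Kolyvagin's Theorem A under the primary author's standing hypothesis «`D ≠ −3,
−4`» (Kolyvagin ICM 1990 p. 431; Gross 1991 Thm. 1.3). Compare the unrestricted
`rank_eq_analyticRank_of_analyticRank_le_one_of_nonempty_modularParametrizationData`
(`HeegnerPointsModularityProofs`). [cite: Darmon2004, Thm. 3.22 and §3.9]
[cite: GrossLMS1991, §1 Thm. 1.3] -/
theorem rank_eq_analyticRank_of_analyticRank_le_one_of_nonempty_modularParametrizationData_of_thmA_discr_ne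
    (h₆ : nonempty_modularParametrizationData)
    (hWa : waldspurger_exists_heegnerField_twist_ne_zero)
    (hMM : murtyMurty_exists_heegnerField_twist_simpleZero)
    (hGZ : ∀ (N : ℕ) [NeZero N] (W : WeierstrassCurve ℚ) (K : Type) [Field K] [NumberField K],
      gross_zagier N W K)
    (hKo : ∀ (N : ℕ) [NeZero N] (W : WeierstrassCurve ℚ) (K : Type) [Field K] [NumberField K],
      NumberField.discr K ≠ -3 ∧ NumberField.discr K ≠ -4 → kolyvagin N W K) :
    rank_eq_analyticRank_of_analyticRank_le_one :=
  rank_eq_analyticRank_of_analyticRank_le_one_of_modularity_of_thmA_discr_ne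
    (existsUnique_isNewformOf_iff.mpr (exists_isNewformOf_of_nonempty_modularParametrizationData h₆))
    hWa hMM hGZ (fun W K _ _ ↦ exists_isHeegnerPoint_of_nonempty_modularParametrizationData W K h₆)
    hKo

/-- **T-r05-U (the referee target as typed by reader r05, `|d_K| > 4` spelling): bsd.S17 from five
named inputs, Kolyvagin's theorem only for Heegner fields with `|d_K| > 4`** — hence never at
`ℚ(√-1)`, `ℚ(√-3)`, the two fields with extra units excluded by Kolyvagin's standing hypothesis.
Antecedents = those of the staging target `rankLeOne_of_kolyvaginPrimary_TARGET`
(`pub/bsd-cited/staging/bsd-cited-r05/KolyvaginPrimaryHypothesesR05.lean` 5982d963bbffc4fe,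
referee C2 R370 (γ)); the guard is converted by
`forall_kolyvagin_discr_ne_iff_forall_kolyvagin_four_lt`.
[cite: Darmon2004, Thm. 3.22 and §3.9] [cite: GrossLMS1991, §1 Thm. 1.3] -/
theorem rank_eq_analyticRank_of_analyticRank_le_one_of_nonempty_modularParametrizationData_of_thmA_four_lt
    (h₆ : nonempty_modularParametrizationData)
    (hWa : waldspurger_exists_heegnerField_twist_ne_zero)
    (hMM : murtyMurty_exists_heegnerField_twist_simpleZero)
    (hGZ : ∀ (N : ℕ) [NeZero N] (W : WeierstrassCurve ℚ) (K : Type) [Field K] [NumberField K],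
      gross_zagier N W K)
    (hKo : ∀ (N : ℕ) [NeZero N] (W : WeierstrassCurve ℚ) (K : Type) [Field K] [NumberField K],
      4 < (NumberField.discr K).natAbs → kolyvagin N W K) :
    rank_eq_analyticRank_of_analyticRank_le_one :=
  rank_eq_analyticRank_of_analyticRank_le_one_of_nonempty_modularParametrizationData_of_thmA_discr_ne
    h₆ hWa hMM hGZ (forall_kolyvagin_discr_ne_iff_forall_kolyvagin_four_lt.mpr hKo)

end TR05U

end Literature.NumberTheory.EllipticCurves

end
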